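import Literature.AlgebraicGeometry.Motives.JacobianAbelSumFibres
import Literature.NumberTheory.DiophantineGeometry.FunctionFieldEllRationalPlaceOfGenusPos
import Literature.AlgebraicGeometry.HodgeTheory.CurveHodgeGenusBound
import Literature.AlgebraicGeometry.Morphisms.FiniteOfClosedFibres
import Mathlib.AlgebraicGeometry.Morphisms.Finite
import HarnessLib

/-!
# The Abel–Jacobi map is injective on points for genus `≥ 1` (Milne, *Jacobian Varieties*, Prop. 2.3)

Topic `Literature/AlgebraicGeometry/Motives`, namespace `Literature.AlgebraicGeometry.Motives.Jacobian`;
THEOREMS ONLY (no definition, no named fact, no instance, sorry-free).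

Milne, *Jacobian Varieties* §2, Prop. 2.3: for a complete nonsingular curve `C` of genus `g > 0` and
`P ∈ C(k)`, the map `f^P : C → J`, `x ↦ [x − P]`, is a closed immersion; the first step of the printed
proof is that `f^P` is INJECTIVE on points: `f^P(x) = f^P(y)` means that the divisors `x` and `y` are
linearly equivalent, which for `g > 0` forces `x = y` (otherwise `C` would carry a function with a single
simple pole, i.e. `C ≅ ℙ¹`). This file proves that step for EVERY Jacobian `𝒥 : Jacobian C` (universal
property of ★ `Motives/Jacobian`) of a smooth projective curve `C` of genus `≥ 1` over an algebraically
closed field `K` of characteristic `0`: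

* `Jacobian.ell_ptDiv_eq_one` — `ℓ([Q]) = 1` for every `Q ∈ C(K)` (the function-field lemma ★
  `AlgFunctionField.ell_single_eq_one_of_one_le_genus` of
  `NumberTheory/DiophantineGeometry/FunctionFieldEllRationalPlaceOfGenusPos`);
* **`Jacobian.comp_abelJacobi_injective`** — `x ↦ f^P(x) = x ≫ 𝒥.abelJacobi P` is injective on
  `C(K)`, for every base point `P` (the case `r = 1` of ★
  `Jacobian.exists_perm_of_prod_comp_abelJacobi_eq_of_ell_eq_one`, Milne Thm. 5.1 (a) for an abstract
  Jacobian, `Motives/JacobianAbelSumFibres`, which transports along Milne's Prop. 6.1 to Weil's model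
  ★ `Motives/WeilJacobianUniversal`);
* `Jacobian.comp_abelJacobi_eq_iff`, **`Jacobian.eq_of_lift_comp_diff_eq_one`** — the base-point-free
  form: `F(x, y) = f^P(x) − f^P(y) = 0` (the difference map `𝒥.diff`, ★ `Jacobian.diff_eq_mul_inv`)
  forces `x = y`;
* §2 (ed. 2) **`Jacobian.comp_abelJacobi_injective_of_isSmoothProjective`**,
  `Jacobian.eq_of_lift_comp_diff_eq_one_of_isSmoothProjective` — the same over `ℂ` in the currency of the
  named fact `Milne1986_abelJacobi_isClosedImmersion` (`IsSmoothProjective 1 C`, `1 ≤ dim J`): `dim J ≤ g(C)`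
  is ★ `HodgeTheory.Jacobian.dim_le_curveGenus`, projectivity ★ `IsSmoothProjective.isProjectiveOver`;
* §3 (ed. 3) **`Jacobian.abelJacobi_base_injective`**, **`Jacobian.isClosedEmbedding_abelJacobi_base`** (and the
  complex forms): the point-set content of «`f^P` is a closed immersion» — `f^P` is injective on the underlying
  topological space of `C` (closed points are `K`-points, ★ `AlgPoints.exists_pt_eq_of_isClosed_singleton`; the generic
  point cannot map to a closed point, else `f^P` would be constant on `K`-points) and, `C → J` being proper
  (Mathlib `IsProper.of_comp`), a CLOSED TOPOLOGICAL EMBEDDING (Mathlib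
  `Topology.IsClosedEmbedding.of_continuous_injective_isClosedMap`);
* §4 (ed. 4) **`Jacobian.isFinite_abelJacobi`** — `f^P` is a FINITE morphism (proper with finite fibres, ★
  `isFinite_of_isProper_of_finite_preimage_closedPoint`), so that by Mathlib `IsClosedImmersion.iff_isFinite_and_mono`
  Milne's Prop. 2.3 is REDUCED to «`f^P` is a monomorphism of schemes» (**`Jacobian.isClosedImmersion_abelJacobi_iff_mono`**),
  i.e. to the tangent-space clause of the printed proof;
* §5 (ed. 5) **`Jacobian.brillNoetherLocus_one_eq_range`** — `W̃₁(P) = f^P(C)` UNCONDITIONALLY (the image is closed, §3),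
  the hypothesis-free form of ★ `Jacobian.brillNoetherLocus_one` of `Motives/JacobianAbelJacobiTranslates`.

Not proved here: the tangent-space half of Prop. 2.3 (`(df^P)` injective, so `f^P` is a closed
immersion) — that is the named fact `Milne1986_abelJacobi_isClosedImmersion` of
`Motives/JacobianAbelJacobiTranslates`, untouched.

Cell `hodgecm-mathlib` (D-0151), count-neutral capital of the (W1) Weil–Jacobian lineage. HC_CM is proved
only modulo the 7 printed citations until rung 0 closes; this file discharges none of them.

## References

* J. S. Milne, *Jacobian Varieties*, in G. Cornell, J. H. Silverman (eds.), *Arithmetic Geometry*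
  (Storrs 1984), Springer 1986, Ch. VII: §2 Prop. 2.3, §5 Thm. 5.1 (a), §6 Prop. 6.1.
  [Milne1986JacobianVarieties]
* H. Stichtenoth, *Algebraic Function Fields and Codes*, 2nd ed., GTM 254, Springer 2009, Prop. 1.6.3.
  [Stichtenoth2009]
-/

set_option autoImplicit false

noncomputable section

universe u

open CategoryTheory CategoryTheory.Limits AlgebraicGeometry MonoidalCategory CartesianMonoidalCategory MonObj
open Literature.NumberTheory.DiophantineGeometry
open Literature.NumberTheory.DiophantineGeometry.AlgFunctionField
open Literature.AlgebraicGeometry.RelativeSpec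

namespace Literature.AlgebraicGeometry.Motives

open RatFn FieldPoint CartierDivisor CurvePlaces

namespace Jacobian

variable {K : Type u} [Field K] [IsAlgClosed K] [CharZero K]
  {C : SchemeOver K} [IsIntegral C.left] [SmoothOfRelativeDimension 1 C.hom] [IsProper C.hom]

omit [CharZero K] in
/-- **`ℓ([Q]) = 1`** for a `K`-point `Q` of a smooth complete curve of genus `≥ 1` over `K = K̄`: the
place of `Q` is rational and `ℓ` of a rational place is `1` when `g ≥ 1`
(★ `AlgFunctionField.ell_single_eq_one_of_one_le_genus`; `genus K(C_K) = genus(C)` by ★ `curveGenus_curveBC`).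
[cite: Milne1986JacobianVarieties, §2 Prop. 2.3 (proof)] [cite: Stichtenoth2009, Prop. 1.6.3] -/
theorem ell_ptDiv_eq_one [GeometricallyIntegral C.hom] (hpos : 1 ≤ curveGenus C) (Q : AlgPoints C K) :
    ell (ptDiv C Q) = 1 := by
  have hg : 1 ≤ genus K (curveBC C (strPt (K := K) K)).left.functionField := by
    have h := curveGenus_curveBC C (strPt (K := K) K)
    unfold curveGenus at h
    rw [h]
    exact hpos
  exact ell_single_eq_one_of_one_le_genus (PlaceOver.isRational_of_isAlgClosed _) hg

/-- **Milne, *Jacobian Varieties*, Prop. 2.3 (injectivity on points): the Abel–Jacobi map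
`f^P : C(K) → J(K)`, `x ↦ [x − P]`, of ANY Jacobian of a smooth projective curve of genus `≥ 1` over an
algebraically closed field of characteristic `0` is injective** — the case `r = 1` of Milne Thm. 5.1 (a)
for an abstract Jacobian (★ `exists_perm_of_prod_comp_abelJacobi_eq_of_ell_eq_one`) at `ℓ([y]) = 1`.
[cite: Milne1986JacobianVarieties, §2 Prop. 2.3 and §5 Thm. 5.1 (a)] -/
theorem comp_abelJacobi_injective (hC : IsProjectiveOver C) (hpos : 1 ≤ curveGenus C) (𝒥 : Jacobian C)
    (P : AlgPoints C K) : Function.Injective fun x : AlgPoints C K => x ≫ 𝒥.abelJacobi P := by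
  haveI : GeometricallyIntegral C.hom := geometricallyIntegral_of_isAlgClosed C.hom
  intro x y h
  have hℓ : ell (tupleDiv C (fun _ : Fin 1 => y)) = 1 := by
    rw [tupleDiv, Fin.sum_univ_one]
    exact ell_ptDiv_eq_one hpos y
  obtain ⟨σ, hσ⟩ := exists_perm_of_prod_comp_abelJacobi_eq_of_ell_eq_one hC hpos 𝒥 P (fun _ : Fin 1 => y) hℓ
    (fun _ : Fin 1 => x) (by simpa only [Fin.prod_univ_one] using h)
  exact congrFun hσ 0

/-- `f^P(x) = f^P(y) ↔ x = y` (genus `≥ 1`, `K = K̄`, `char K = 0`). [cite: Milne1986JacobianVarieties, §2 Prop. 2.3] -/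
theorem comp_abelJacobi_eq_iff (hC : IsProjectiveOver C) (hpos : 1 ≤ curveGenus C) (𝒥 : Jacobian C)
    (P x y : AlgPoints C K) : x ≫ 𝒥.abelJacobi P = y ≫ 𝒥.abelJacobi P ↔ x = y :=
  ⟨fun h => comp_abelJacobi_injective hC hpos 𝒥 P h, fun h => by rw [h]⟩

/-- **Base-point-free form: `F(x, y) = 0` forces `x = y`.** For the difference map `F = 𝒥.diff : C × C → J`
of any Jacobian (`F(x, y) = f^P(x) · f^P(y)⁻¹`, ★ `Jacobian.diff_eq_mul_inv`), genus `≥ 1`, `K = K̄`,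
`char K = 0`: if the `K`-point `(x, y)` of `C × C` goes to the origin then `x = y`.
[cite: Milne1986JacobianVarieties, §2 Prop. 2.3 and §6 (the map F)] -/
theorem eq_of_lift_comp_diff_eq_one (hC : IsProjectiveOver C) (hpos : 1 ≤ curveGenus C) (𝒥 : Jacobian C)
    (x y : AlgPoints C K) (h : lift x y ≫ 𝒥.diff = 1) : x = y := by
  obtain ⟨P⟩ : Nonempty (AlgPoints C K) := ⟨x⟩
  rw [𝒥.diff_eq_mul_inv P, MonObj.comp_mul, GrpObj.comp_inv, lift_fst_assoc, lift_snd_assoc,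
    mul_inv_eq_one] at h
  exact comp_abelJacobi_injective hC hpos 𝒥 P h

/-- `F(x, y) = 0 ↔ x = y` on `K`-points (genus `≥ 1`, `K = K̄`, `char K = 0`); `F(x, x) = 0` is ★ `Jacobian.diag_diff`.
[cite: Milne1986JacobianVarieties, §2 Prop. 2.3 and §6 (the map F)] -/
theorem lift_comp_diff_eq_one_iff (hC : IsProjectiveOver C) (hpos : 1 ≤ curveGenus C) (𝒥 : Jacobian C)
    (x y : AlgPoints C K) : lift x y ≫ 𝒥.diff = 1 ↔ x = y := by
  refine ⟨eq_of_lift_comp_diff_eq_one hC hpos 𝒥 x y, ?_⟩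
  rintro rfl
  rw [show lift x x = x ≫ lift (𝟙 C) (𝟙 C) by simp, Category.assoc, 𝒥.diag_diff, MonObj.comp_one]

end Jacobian

/-! ## §2 (ed. 2) Complex curves: the hypotheses of `Milne1986_abelJacobi_isClosedImmersion` at `k = ℂ` -/

namespace Jacobian

/-- **Milne, *Jacobian Varieties*, Prop. 2.3 (injectivity on points) for a smooth projective COMPLEX curve
with `dim J ≥ 1`**: for every Jacobian `𝒥` of `C` and every base point `P ∈ C(ℂ)`, `x ↦ f^P(x)` is injective
on `C(ℂ)` — exactly the point-set half of the named fact `Milne1986_abelJacobi_isClosedImmersion`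
(`Motives/JacobianAbelJacobiTranslates`) at `k = ℂ`. From §1: `1 ≤ dim J ≤ g(C)`
(★ `HodgeTheory.Jacobian.dim_le_curveGenus`, Milne Prop. 2.1) and `C` is projective over `ℂ`
(★ `IsSmoothProjective.isProjectiveOver`). [cite: Milne1986JacobianVarieties, §2 Prop. 2.3 and Prop. 2.1] -/
theorem comp_abelJacobi_injective_of_isSmoothProjective {C : SchemeOver ℂ} (hC : IsSmoothProjective 1 C)
    (𝒥 : Jacobian C) (hdim : 1 ≤ 𝒥.J.dim) (P : AlgPoints C ℂ) :
    Function.Injective fun x : AlgPoints C ℂ => x ≫ 𝒥.abelJacobi P := by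
  haveI : IsIntegral C.left := IsSmoothProjective.isIntegral_holds hC
  haveI : SmoothOfRelativeDimension 1 C.hom := hC.smoothOfRelativeDimension
  haveI : IsProper C.hom := IsSmoothProjective.isProper_holds hC
  have hproj : IsProjectiveOver C := hC.isProjectiveOver
  have hle : 𝒥.J.dim ≤ curveGenus C :=
    Literature.AlgebraicGeometry.HodgeTheory.Jacobian.dim_le_curveGenus (C := C) hC 𝒥
  exact comp_abelJacobi_injective hproj (hdim.trans hle) 𝒥 P

/-- `f^P(x) = f^P(y) ↔ x = y` for a smooth projective complex curve with `dim J ≥ 1`.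
[cite: Milne1986JacobianVarieties, §2 Prop. 2.3] -/
theorem comp_abelJacobi_eq_iff_of_isSmoothProjective {C : SchemeOver ℂ} (hC : IsSmoothProjective 1 C)
    (𝒥 : Jacobian C) (hdim : 1 ≤ 𝒥.J.dim) (P x y : AlgPoints C ℂ) :
    x ≫ 𝒥.abelJacobi P = y ≫ 𝒥.abelJacobi P ↔ x = y :=
  ⟨fun h => comp_abelJacobi_injective_of_isSmoothProjective hC 𝒥 hdim P h, fun h => by rw [h]⟩

/-- **`F(x, y) = 0` forces `x = y`** for the difference map of any Jacobian of a smooth projective complex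
curve with `dim J ≥ 1` (★ `Jacobian.diff_eq_mul_inv`). [cite: Milne1986JacobianVarieties, §2 Prop. 2.3 and §6 (the map F)] -/
theorem eq_of_lift_comp_diff_eq_one_of_isSmoothProjective {C : SchemeOver ℂ} (hC : IsSmoothProjective 1 C)
    (𝒥 : Jacobian C) (hdim : 1 ≤ 𝒥.J.dim) (x y : AlgPoints C ℂ) (h : lift x y ≫ 𝒥.diff = 1) : x = y := by
  rw [𝒥.diff_eq_mul_inv x, MonObj.comp_mul, GrpObj.comp_inv, lift_fst_assoc, lift_snd_assoc,
    mul_inv_eq_one] at h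
  exact comp_abelJacobi_injective_of_isSmoothProjective hC 𝒥 hdim x h

end Jacobian

/-! ## §3 (ed. 3) Injectivity on the underlying space; `f^P` is a closed topological embedding -/

namespace Jacobian

section Topological

variable {K : Type u} [Field K] [IsAlgClosed K] [CharZero K]
  {C : SchemeOver K} [IsIntegral C.left] [SmoothOfRelativeDimension 1 C.hom] [IsProper C.hom]

omit [IsAlgClosed K] [CharZero K] [IsIntegral C.left] [SmoothOfRelativeDimension 1 C.hom] [IsProper C.hom] in
/-- `f^P(z) = (z ≫ f^P).pt` on `K`-points. [folklore] -/
private theorem abelJacobi_base_pt (𝒥 : Jacobian C) (P z : AlgPoints C K) :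
    (𝒥.abelJacobi P).left.base z.pt = (AlgPoints.map (𝒥.abelJacobi P) z).pt :=
  (AlgPoints.pt_map _ _).symm

/-- Injectivity of `f^P` on the closed (= `K`-) points of `C`, read on underlying points. [cite: Milne1986JacobianVarieties, §2 Prop. 2.3] -/
private theorem eq_of_abelJacobi_base_pt_eq (hC : IsProjectiveOver C) (hpos : 1 ≤ curveGenus C) (𝒥 : Jacobian C)
    (P z₁ z₂ : AlgPoints C K) (h : (𝒥.abelJacobi P).left.base z₁.pt = (𝒥.abelJacobi P).left.base z₂.pt) :
    z₁ = z₂ := by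
  rw [abelJacobi_base_pt, abelJacobi_base_pt] at h
  have h' : AlgPoints.map (𝒥.abelJacobi P) z₁ = AlgPoints.map (𝒥.abelJacobi P) z₂ := AlgPoints.eq_of_pt_eq h
  exact comp_abelJacobi_injective hC hpos 𝒥 P h'

/-- **The generic point of `C` does not go to a closed point of `J`** (genus `≥ 1`): otherwise every
`K`-point `z`, a specialisation of the generic point, would have the same image, and `f^P` would be
constant on the (infinitely many) `K`-points of `C`. [cite: Milne1986JacobianVarieties, §2 Prop. 2.3] -/
theorem not_isClosed_abelJacobi_base_genericPoint (hC : IsProjectiveOver C) (hpos : 1 ≤ curveGenus C)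
    (𝒥 : Jacobian C) (P : AlgPoints C K) :
    ¬ IsClosed ({(𝒥.abelJacobi P).left.base (genericPoint C.left)} : Set 𝒥.J.X.left) := by
  intro hcl
  haveI := infinite_algPoints C
  -- every `K`-point has the same image as the generic point
  have hconst : ∀ z : AlgPoints C K,
      (𝒥.abelJacobi P).left.base z.pt = (𝒥.abelJacobi P).left.base (genericPoint C.left) := fun z => by
    have hspec : (𝒥.abelJacobi P).left.base (genericPoint C.left) ⤳ (𝒥.abelJacobi P).left.base z.pt :=
      ((genericPoint_spec C.left).specializes trivial).map (𝒥.abelJacobi P).left.base.hom.continuous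
    have hmem := specializes_iff_mem_closure.mp hspec
    rw [hcl.closure_eq, Set.mem_singleton_iff] at hmem
    exact hmem
  obtain ⟨z₁, z₂, hne⟩ := exists_pair_ne (AlgPoints C K)
  exact hne (eq_of_abelJacobi_base_pt_eq hC hpos 𝒥 P z₁ z₂ ((hconst z₁).trans (hconst z₂).symm))

/-- **`f^P` is injective on the underlying topological space of `C`** (genus `≥ 1`, `K = K̄`,
`char K = 0`): on closed points this is injectivity on `K`-points (§1; closed points of a `K̄`-scheme of
finite type are `K`-points), and the generic point is the only non-closed point of the curve and does not
map to a closed point. [cite: Milne1986JacobianVarieties, §2 Prop. 2.3] -/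
theorem abelJacobi_base_injective (hC : IsProjectiveOver C) (hpos : 1 ≤ curveGenus C) (𝒥 : Jacobian C)
    (P : AlgPoints C K) : Function.Injective (𝒥.abelJacobi P).left.base := by
  intro x y hxy
  by_cases hx : x = genericPoint C.left
  · by_cases hy : y = genericPoint C.left
    · rw [hx, hy]
    · exfalso
      obtain ⟨zy, hzy⟩ := AlgPoints.exists_pt_eq_of_isClosed_singleton (X := C) (CurvePlaces.isClosed_singleton C hy)
      apply not_isClosed_abelJacobi_base_genericPoint hC hpos 𝒥 P
      rw [← hx, hxy, ← hzy, abelJacobi_base_pt]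
      exact AlgPoints.isClosed_singleton_pt _
  · obtain ⟨zx, hzx⟩ := AlgPoints.exists_pt_eq_of_isClosed_singleton (X := C) (CurvePlaces.isClosed_singleton C hx)
    by_cases hy : y = genericPoint C.left
    · exfalso
      apply not_isClosed_abelJacobi_base_genericPoint hC hpos 𝒥 P
      rw [← hy, ← hxy, ← hzx, abelJacobi_base_pt]
      exact AlgPoints.isClosed_singleton_pt _
    · obtain ⟨zy, hzy⟩ := AlgPoints.exists_pt_eq_of_isClosed_singleton (X := C) (CurvePlaces.isClosed_singleton C hy)
      rw [← hzx, ← hzy] at hxy ⊢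
      rw [eq_of_abelJacobi_base_pt_eq hC hpos 𝒥 P zx zy hxy]

/-- **`f^P : C → J` is a closed topological embedding** (genus `≥ 1`, `K = K̄`, `char K = 0`): proper
(`C` proper, `J` separated over `K`: Mathlib `IsProper.of_comp`), hence closed, continuous and injective —
the point-set content of Milne's «`f^P` is a closed immersion». [cite: Milne1986JacobianVarieties, §2 Prop. 2.3] -/
theorem isClosedEmbedding_abelJacobi_base (hC : IsProjectiveOver C) (hpos : 1 ≤ curveGenus C) (𝒥 : Jacobian C)
    (P : AlgPoints C K) : Topology.IsClosedEmbedding (𝒥.abelJacobi P).left.base := by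
  haveI : IsProper ((𝒥.abelJacobi P).left ≫ 𝒥.J.X.hom) := by
    rw [Over.w (𝒥.abelJacobi P)]; infer_instance
  haveI : IsProper (𝒥.abelJacobi P).left := IsProper.of_comp (𝒥.abelJacobi P).left 𝒥.J.X.hom
  exact .of_continuous_injective_isClosedMap (𝒥.abelJacobi P).left.base.hom.continuous
    (abelJacobi_base_injective hC hpos 𝒥 P) (𝒥.abelJacobi P).left.isClosedMap

/-- The image `f^P(C)` is closed in `J` (genus `≥ 1`, `K = K̄`, `char K = 0`). [cite: Milne1986JacobianVarieties, §2 Prop. 2.3] -/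
theorem isClosed_range_abelJacobi_base (hC : IsProjectiveOver C) (hpos : 1 ≤ curveGenus C) (𝒥 : Jacobian C)
    (P : AlgPoints C K) : IsClosed (Set.range (𝒥.abelJacobi P).left.base) :=
  (isClosedEmbedding_abelJacobi_base hC hpos 𝒥 P).isClosed_range

end Topological

/-- **`f^P` is a closed topological embedding for a smooth projective complex curve with `dim J ≥ 1`**
(the currency of `Milne1986_abelJacobi_isClosedImmersion` at `k = ℂ`; point-set content only).
[cite: Milne1986JacobianVarieties, §2 Prop. 2.3 and Prop. 2.1] -/
theorem isClosedEmbedding_abelJacobi_base_of_isSmoothProjective {C : SchemeOver ℂ} (hC : IsSmoothProjective 1 C)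
    (𝒥 : Jacobian C) (hdim : 1 ≤ 𝒥.J.dim) (P : AlgPoints C ℂ) :
    Topology.IsClosedEmbedding (𝒥.abelJacobi P).left.base := by
  haveI : IsIntegral C.left := IsSmoothProjective.isIntegral_holds hC
  haveI : SmoothOfRelativeDimension 1 C.hom := hC.smoothOfRelativeDimension
  haveI : IsProper C.hom := IsSmoothProjective.isProper_holds hC
  have hproj : IsProjectiveOver C := hC.isProjectiveOver
  have hle : 𝒥.J.dim ≤ curveGenus C :=
    Literature.AlgebraicGeometry.HodgeTheory.Jacobian.dim_le_curveGenus (C := C) hC 𝒥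
  exact isClosedEmbedding_abelJacobi_base hproj (hdim.trans hle) 𝒥 P

/-- `f^P` is injective on the underlying space for a smooth projective complex curve with `dim J ≥ 1`.
[cite: Milne1986JacobianVarieties, §2 Prop. 2.3] -/
theorem abelJacobi_base_injective_of_isSmoothProjective {C : SchemeOver ℂ} (hC : IsSmoothProjective 1 C)
    (𝒥 : Jacobian C) (hdim : 1 ≤ 𝒥.J.dim) (P : AlgPoints C ℂ) :
    Function.Injective (𝒥.abelJacobi P).left.base :=
  (isClosedEmbedding_abelJacobi_base_of_isSmoothProjective hC 𝒥 hdim P).injective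

end Jacobian

/-! ## §4 (ed. 4) `f^P` is finite; Prop. 2.3 reduces to «`f^P` is a monomorphism» -/

namespace Jacobian

section Finite

variable {K : Type u} [Field K] [IsAlgClosed K] [CharZero K]
  {C : SchemeOver K} [IsIntegral C.left] [SmoothOfRelativeDimension 1 C.hom] [IsProper C.hom]

omit [IsAlgClosed K] [CharZero K] [IsIntegral C.left] [SmoothOfRelativeDimension 1 C.hom] in
/-- `f^P : C → J` is proper (`C` proper, `J` separated over `K`). [cite: Milne1986JacobianVarieties, §2 Prop. 2.3] -/
theorem isProper_abelJacobi (𝒥 : Jacobian C) (P : AlgPoints C K) : IsProper (𝒥.abelJacobi P).left := by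
  haveI : IsProper ((𝒥.abelJacobi P).left ≫ 𝒥.J.X.hom) := by
    rw [Over.w (𝒥.abelJacobi P)]; infer_instance
  exact IsProper.of_comp (𝒥.abelJacobi P).left 𝒥.J.X.hom

/-- **`f^P : C → J` is a FINITE morphism** (genus `≥ 1`, `K = K̄`, `char K = 0`): proper with finite
(indeed subsingleton, §3) fibres over closed points (★ `Morphisms.isFinite_of_isProper_of_finite_preimage_closedPoint`,
`J` Jacobson). [cite: Milne1986JacobianVarieties, §2 Prop. 2.3] -/
theorem isFinite_abelJacobi (hC : IsProjectiveOver C) (hpos : 1 ≤ curveGenus C) (𝒥 : Jacobian C)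
    (P : AlgPoints C K) : IsFinite (𝒥.abelJacobi P).left := by
  haveI := 𝒥.isProper_abelJacobi P
  haveI : JacobsonSpace 𝒥.J.X.left := LocallyOfFiniteType.jacobsonSpace 𝒥.J.X.hom
  exact Morphisms.isFinite_of_isProper_of_finite_preimage_closedPoint (𝒥.abelJacobi P).left fun y _ =>
    ((Set.subsingleton_singleton (a := y)).preimage (abelJacobi_base_injective hC hpos 𝒥 P)).finite

/-- **Milne Prop. 2.3 reduced to a monomorphism statement**: since `f^P` is finite, `f^P` is a closed
immersion iff it is a monomorphism of schemes (Mathlib `IsClosedImmersion.iff_isFinite_and_mono`) — what is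
left of the printed proof is the tangent-space clause «`(df^P)_Q : T_Q(C) → T_0(J)` is injective»
(Milne, via `Γ(C, Ω¹(−Q)) ⊊ Γ(C, Ω¹)`, cf. ★ `AlgFunctionField.riemannRochSpace_differentialDivisor_sub_single_lt`).
[cite: Milne1986JacobianVarieties, §2 Prop. 2.3 (proof) and Prop. 2.2] -/
theorem isClosedImmersion_abelJacobi_iff_mono (hC : IsProjectiveOver C) (hpos : 1 ≤ curveGenus C)
    (𝒥 : Jacobian C) (P : AlgPoints C K) :
    IsClosedImmersion (𝒥.abelJacobi P).left ↔ Mono (𝒥.abelJacobi P).left := by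
  rw [IsClosedImmersion.iff_isFinite_and_mono]
  exact ⟨fun h => h.2, fun h => ⟨isFinite_abelJacobi hC hpos 𝒥 P, h⟩⟩

end Finite

/-- `f^P` is finite for a smooth projective complex curve with `dim J ≥ 1`. [cite: Milne1986JacobianVarieties, §2 Prop. 2.3] -/
theorem isFinite_abelJacobi_of_isSmoothProjective {C : SchemeOver ℂ} (hC : IsSmoothProjective 1 C)
    (𝒥 : Jacobian C) (hdim : 1 ≤ 𝒥.J.dim) (P : AlgPoints C ℂ) : IsFinite (𝒥.abelJacobi P).left := by
  haveI : IsIntegral C.left := IsSmoothProjective.isIntegral_holds hC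
  haveI : SmoothOfRelativeDimension 1 C.hom := hC.smoothOfRelativeDimension
  haveI : IsProper C.hom := IsSmoothProjective.isProper_holds hC
  have hproj : IsProjectiveOver C := hC.isProjectiveOver
  have hle : 𝒥.J.dim ≤ curveGenus C :=
    Literature.AlgebraicGeometry.HodgeTheory.Jacobian.dim_le_curveGenus (C := C) hC 𝒥
  exact isFinite_abelJacobi hproj (hdim.trans hle) 𝒥 P

/-- For a smooth projective complex curve with `dim J ≥ 1`: `f^P` is a closed immersion iff it is a
monomorphism. [cite: Milne1986JacobianVarieties, §2 Prop. 2.3 (proof) and Prop. 2.2] -/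
theorem isClosedImmersion_abelJacobi_iff_mono_of_isSmoothProjective {C : SchemeOver ℂ}
    (hC : IsSmoothProjective 1 C) (𝒥 : Jacobian C) (hdim : 1 ≤ 𝒥.J.dim) (P : AlgPoints C ℂ) :
    IsClosedImmersion (𝒥.abelJacobi P).left ↔ Mono (𝒥.abelJacobi P).left := by
  rw [IsClosedImmersion.iff_isFinite_and_mono]
  exact ⟨fun h => h.2, fun h => ⟨isFinite_abelJacobi_of_isSmoothProjective hC 𝒥 hdim P, h⟩⟩

end Jacobian

/-! ## §5 (ed. 5) `W̃₁(P) = f^P(C)` unconditionally -/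

namespace Jacobian

section BrillNoetherOne

variable {K : Type u} [Field K] [IsAlgClosed K] [CharZero K]
  {C : SchemeOver K} [IsIntegral C.left] [SmoothOfRelativeDimension 1 C.hom] [IsProper C.hom]

omit [IsAlgClosed K] [CharZero K] [IsIntegral C.left] [SmoothOfRelativeDimension 1 C.hom] [IsProper C.hom] in
/-- The one-factor Abel sum and `f^P` have the same image (`C¹ → C` has a section). [cite: Milne1986JacobianVarieties, §5 (the maps f^r)] -/
theorem range_abelSum_one_base (𝒥 : Jacobian C) (P : AlgPoints C K) :
    Set.range (𝒥.abelSum P 1).left.base = Set.range (𝒥.abelJacobi P).left.base := by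
  rw [show 𝒥.abelSum P 1 = (RelativeSpec.projOver C.hom 1 0 : RelativeSpec.powOverObj C.hom 1 ⟶ C) ≫ 𝒥.abelJacobi P from
    Fin.prod_univ_one _]
  change Set.range ((RelativeSpec.projOver C.hom 1 0).left ≫ (𝒥.abelJacobi P).left).base = _
  apply le_antisymm
  · rintro _ ⟨x, rfl⟩
    exact ⟨(RelativeSpec.projOver C.hom 1 0).left x, rfl⟩
  · rintro _ ⟨x, rfl⟩
    let σ : C ⟶ RelativeSpec.powOverObj C.hom 1 := RelativeSpec.liftOver C.hom 1 fun _ => 𝟙 C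
    have hσ : σ ≫ RelativeSpec.projOver C.hom 1 0 = 𝟙 C := RelativeSpec.liftOver_projOver C.hom 1 _ 0
    refine ⟨σ.left x, ?_⟩
    rw [Scheme.Hom.comp_apply, ← Scheme.Hom.comp_apply _ (RelativeSpec.projOver C.hom 1 0).left,
      ← Over.comp_left, hσ]
    rfl

/-- **`W̃₁(P) = f^P(C)`** unconditionally (genus `≥ 1`, `K = K̄`, `char K = 0`): `W̃₁(P)` is the closure of the
image of the one-factor Abel sum, i.e. of `f^P(C)`, which is closed (§3); hypothesis-free form of ★
`Jacobian.brillNoetherLocus_one`. [cite: Milne1986JacobianVarieties, §2 Prop. 2.3 and §5 (W^1 = f(C))] -/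
theorem brillNoetherLocus_one_eq_range (hC : IsProjectiveOver C) (hpos : 1 ≤ curveGenus C) (𝒥 : Jacobian C)
    (P : AlgPoints C K) : 𝒥.brillNoetherLocus P 1 = Set.range (𝒥.abelJacobi P).left.base := by
  rw [brillNoetherLocus, range_abelSum_one_base, (isClosed_range_abelJacobi_base hC hpos 𝒥 P).closure_eq]

end BrillNoetherOne

/-- `W̃₁(P) = f^P(C)` for a smooth projective complex curve with `dim J ≥ 1`. [cite: Milne1986JacobianVarieties, §2 Prop. 2.3 and §5 (W^1 = f(C))] -/
theorem brillNoetherLocus_one_eq_range_of_isSmoothProjective {C : SchemeOver ℂ} (hC : IsSmoothProjective 1 C)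
    (𝒥 : Jacobian C) (hdim : 1 ≤ 𝒥.J.dim) (P : AlgPoints C ℂ) :
    𝒥.brillNoetherLocus P 1 = Set.range (𝒥.abelJacobi P).left.base := by
  rw [brillNoetherLocus, range_abelSum_one_base,
    (isClosedEmbedding_abelJacobi_base_of_isSmoothProjective hC 𝒥 hdim P).isClosed_range.closure_eq]

end Jacobian

end Literature.AlgebraicGeometry.Motives

end
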